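import Summits.HodgeConjecture.HodgeConjecture.Theses.HeckePrymWeil
import Summits.HodgeConjecture.HodgeConjecture.Theorems.WeilTenfoldsSqrtMinus11.Negative.EigenvalueSeparation
import Literature.AlgebraicGeometry.Motives.AbelianVarietyProduct
import Literature.AlgebraicGeometry.Motives.AbelianVarietyProductDimProofs
import Literature.AlgebraicGeometry.Motives.Jacobian
import Literature.AlgebraicGeometry.HodgeTheory.WeilClassesFourfoldsProofs

/-!
# Crux-plan sketch for idea `balanced-undecic-pencil` — crux `HeckePrymWeil.WeilTenfoldsSqrtMinus11`
(item stmt-HodgeConjecture-1262; seat `planner-cruxplan-stmt-HodgeConjecture-1262-balanced-undecic-pen-0`,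
2026-08-16).  VERDICT of the crux-plan: **no-skeleton** for the pencil lever as triaged (the pencil and its
principal cusps live in the hyperbolic component `δ = -1` only; a composition concluding the crux BY NAME
would need a costume stub for `δ ≠ -1`; see `Lines/balanced-undecic-pencil.md`).  This file is the
CHECKED residue of the planning, in three parts, all sorry-free:

* §1 `PencilCase` — the crux restricted to the pencil's own objects, typed on the tree's REAL carriers
  (`Motives.Jacobian` of a smooth projective curve `C` with an automorphism `σ` of order `11`,
  `ζ = σ_*` on `J(C)`, `dim J = 10`, vanishing norm `Σ_{k<11} ζ^k = 0` — i.e. `C/σ ≅ ℙ¹`, four branch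
  points by Riemann–Hurwitz: the balanced undecic pencil `x⁴ = y¹¹(x-1)²(x-a)` together with the 15 dihedral
  balanced patterns (decomposable `W`, known) and the unbalanced ones (vacuous by the `(5,5)` hypothesis)),
  with `pencilCase_of_crux : Crux → PencilCase` kernel-checked.  This is the named TEST STUB the three
  triagers asked to hand to the closing lines (merged QM-anchor line, secant descent, graph seeds).
* §2 `JunctionCase` — the planning's new finding (ODD-RANK JUNCTION, filed as its own crux idea
  `odd-rank-junction`): the crux restricted to the K-split hosts `(B × B, ψ × (-ψ))`, `B` ANY abelian
  5-fold with `ψ ≫ ψ = -11` (the pencil's compact-type cusp `J₁ × J₁^{(8)}`, `J₁ = J(y¹¹ = x⁵(x-1)⁴)`,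
  `φ₀ = g(ζ) × g(ζ⁸) = g × (-g)`, is the instance the pencil points at).  `junctionCase_of_crux` is
  kernel-checked; on paper `JunctionCase` is TRUE (the Weil plane of `B × B^c` is spanned by the class of
  the projector-graph cycle `p(Γ_{𝟙+ψ})`, §3).  The junction lemma `oddRank_reweighting` records the lever:
  re-weighting the product polarisation `a E₁ ⊕ d E₂` multiplies `det H` by `a⁵ d⁵ ≡ a d` modulo squares,
  so ONE such host, re-polarised, lies in the component of EVERY discriminant `δ ∈ ℚ^×_{<0}/Nm(K^×)` while
  its Weil plane and the pure-Chern-character graph K-class do not see the polarisation.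
* §3 `WeilProjectorPolynomialDeg m` — the seed arithmetic of card `weil-projector-graph-seeds` for an
  ARBITRARY top degree `m` (the card proved the even case `m = 2n`; the junction host needs `m = 5 = dim B`,
  odd): a polynomial taking the value `1` at `(1 ± i√11)^m` and `0` at every other
  `(1+i√11)ᵃ(1-i√11)ᵇ`, `(a,b) ∈ [0,m]²`.  Proof adapted from `IdeatorTwoSketchG2.weilProjectorPolynomial_holds`
  (ideator 2, gen 2), using the LANDED separation lemmas of `…Theorems.WeilTenfoldsSqrtMinus11.Negative`.

Disproof used (`Cruxes/WeilTenfoldsSqrtMinus11/Disproof.lean`, cycle 1): (F1) every statement here is a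
SPECIAL CASE of the crux (`*_of_crux`), hence irrefutable short of `¬HC`; §B `WithoutHodgeType` false —
both cases keep `hhodge`; SCOPE REMARK (every `δ`) — it is exactly what kills the pencil as a closing line
(§1) and what the junction (§2) answers; §C separation — used in §3 (`weil_mixed_ne_plus/minus`, landed
p73707).  `gaussSum`/`gaussSum_sq` are copied verbatim (with attribution) from `IdeatorTwoSketch.lean`
(planner-cruxidea-stmt-HodgeConjecture-1262-2-0) to keep this file self-contained.
-/

set_option linter.dupNamespace false

noncomputable section

open CategoryTheory Complex Polynomial

namespace Summit.HodgeConjecture.HodgeConjecture.Cruxes.WeilTenfoldsSqrtMinus11.PencilPlan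

open Literature.AlgebraicGeometry Literature.AlgebraicGeometry.Motives
  Literature.AlgebraicGeometry.HodgeTheory
open Summit.HodgeConjecture.HodgeConjecture.Theorems.WeilTenfoldsSqrtMinus11.Negative

/-- The crux, by name. -/
abbrev Crux : Prop := Summit.HodgeConjecture.HodgeConjecture.Theses.HeckePrymWeil.WeilTenfoldsSqrtMinus11

/-! ## §0 Common typing (verbatim the route's) -/

/-- The complexified Weil plane of `(A, φ)` in degree 10, typed exactly as in the crux:
`Eig((𝟙+φ)^*, (1+i√11)^10) ⊔ Eig((𝟙+φ)^*, (1-i√11)^10)`. -/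
def weilPlane (A : AbelianVariety ℂ) (φ : A ⟶ A) : Submodule ℂ (complexBetti A.X 10) :=
  Module.End.eigenspace (complexBetti.map (𝟙 A + φ).hom.hom.hom 10).hom
      ((1 + Complex.I * (Real.sqrt (11 : ℝ) : ℂ)) ^ 10) ⊔
    Module.End.eigenspace (complexBetti.map (𝟙 A + φ).hom.hom.hom 10).hom
      ((1 - Complex.I * (Real.sqrt (11 : ℝ) : ℂ)) ^ 10)

/-- Read-back of the crux through `weilPlane` (definitional). -/
theorem crux_iff :
    Crux ↔ ∀ (A : AbelianVariety ℂ) (φ : A ⟶ A), A.dim = 10 → φ ≫ φ = -((11 : ℤ) • 𝟙 A) →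
      ∀ c : complexBetti A.X 10, IsRationalClass c → IsOfHodgeType 10 A.X 10 5 5 c →
        c ∈ weilPlane A φ → c ∈ algebraicClasses A.X 5 :=
  Iff.rfl

/-- The quadratic GAUSS SUM in an endomorphism `z`: `g(z) = Σ_{k=1}^{10} (k/11) zᵏ` (squares mod 11
= `{1,3,4,5,9}`), in the ring `End A`.  [copied from `IdeatorTwoSketch.gaussSum`] -/
def gaussSum (A : AbelianVariety ℂ) (z : CategoryTheory.End A) : CategoryTheory.End A :=
  z + z ^ 3 + z ^ 4 + z ^ 5 + z ^ 9 - z ^ 2 - z ^ 6 - z ^ 7 - z ^ 8 - z ^ 10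

/-- `g(ζ)² = -11` when `ζ¹¹ = 1` and `Σ_{k<11} ζᵏ = 0`.  [copied from `IdeatorTwoSketch.gaussSum_sq`,
planner-cruxidea-stmt-HodgeConjecture-1262-2-0, PROVED there; reproduced verbatim] -/
theorem gaussSum_sq (A : AbelianVariety ℂ) (z : CategoryTheory.End A) (h11 : z ^ 11 = 1)
    (hnorm : (Finset.range 11).sum (fun k => z ^ k) = 0) :
    CategoryStruct.comp (gaussSum A z) (gaussSum A z) = -((11 : ℤ) • 𝟙 A) := by
  set q : CategoryTheory.End A := z ^ 1 + z ^ 3 + z ^ 4 + z ^ 5 + z ^ 9 with hq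
  set n : CategoryTheory.End A := z ^ 2 + z ^ 6 + z ^ 7 + z ^ 8 + z ^ 10 with hn
  have hred : ∀ m : ℕ, z ^ (11 + m) = z ^ m := fun m => by rw [pow_add, h11, one_mul]
  have h12 : z ^ 12 = z ^ 1 := hred 1
  have h13 : z ^ 13 = z ^ 2 := hred 2
  have h14 : z ^ 14 = z ^ 3 := hred 3
  have h18 : z ^ 18 = z ^ 7 := hred 7
  have hs : (Finset.range 11).sum (fun k => z ^ k) = 1 + q + n := by
    simp only [Finset.sum_range_succ, Finset.sum_range_zero, pow_zero, hq, hn]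
    abel
  have hn' : n = -1 - q := by
    have h := hnorm
    rw [hs] at h
    have : n = -(1 + q) := eq_neg_of_add_eq_zero_right h
    rw [this]; abel
  have hq2 : q * q = 2 • q + 3 • n := by
    simp only [hq, hn, mul_add, add_mul, ← pow_add, Nat.reduceAdd, h12, h13, h14, h18]
    simp only [two_smul, three_nsmul]
    abel
  have hg : gaussSum A z = 2 • q + 1 := by
    have : gaussSum A z = q - n := by
      simp only [gaussSum, hq, hn, pow_one]
      abel
    rw [this, hn']
    abel
  have hmul : CategoryStruct.comp (gaussSum A z) (gaussSum A z) = gaussSum A z * gaussSum A z := rfl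
  rw [hmul, hg]
  have hexp : (2 • q + 1) * (2 • q + 1) = 4 • (q * q) + 4 • q + 1 := by noncomm_ring
  rw [hexp, hq2, hn']
  change (4 • (2 • q + 3 • (-1 - q)) + 4 • q + 1 : CategoryTheory.End A) =
    -((11 : ℤ) • (1 : CategoryTheory.End A))
  module

/-! ## §1 The pencil as a typed TEST STUB: `PencilCase` -/

section Pencil

variable {C : SchemeOver ℂ} (𝒥 : Jacobian C)

/-- Albanese functoriality `σ ↦ σ_*` as a monoid homomorphism `End C →* End J(C)` (multiplication in
`CategoryTheory.End` is composition in reverse order on both sides; `pushforward_comp`, `pushforward_id`). -/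
def pushforwardEnd : CategoryTheory.End C →* CategoryTheory.End 𝒥.J where
  toFun σ := 𝒥.pushforward 𝒥 σ
  map_one' := 𝒥.pushforward_id
  map_mul' f g := by
    change 𝒥.pushforward 𝒥 (g ≫ f) = 𝒥.pushforward 𝒥 g ≫ 𝒥.pushforward 𝒥 f
    exact Jacobian.pushforward_comp 𝒥 𝒥 𝒥 g f

@[simp] theorem pushforwardEnd_apply (σ : CategoryTheory.End C) :
    pushforwardEnd 𝒥 σ = 𝒥.pushforward 𝒥 σ := rfl

/-- An automorphism of order dividing `11` of the curve induces `ζ = σ_*` with `ζ¹¹ = 1` on `J(C)`. -/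
theorem pushforward_pow_eleven (σ : CategoryTheory.End C) (h11 : σ ^ 11 = 1) :
    (pushforwardEnd 𝒥 σ) ^ 11 = 1 := by
  rw [← map_pow, h11, map_one]

end Pencil

/-- **`PencilCase` — the crux on the balanced undecic pencil (and its degenerate companions).**
For every smooth projective curve `C/ℂ`, every Jacobian `J` of `C` (`Motives.Jacobian`), and every
endomorphism `σ` of `C` with `σ¹¹ = 𝟙` such that `dim J = 10` and the norm `Σ_{k<11} (σ_*)ᵏ` vanishes on
`J` (⟺ `J(C/σ) = 0` ⟺ `C/σ ≅ ℙ¹`; with `g = 10` Riemann–Hurwitz forces exactly four branch points, so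
`C : y¹¹ = ∏(x-bᵢ)^{mᵢ}` and, when `J` is of Weil type `(5,5)` — the only case in which the `(5,5)`
hypothesis is not vacuous — the exponent pattern is BALANCED: the unique non-dihedral unit orbit
`(3,4,2,2) ~ (4,9,10,10)`, i.e. the pencil `x⁴ = y¹¹(x-1)²(x-a)`, or one of the 15 dihedral patterns
`(a,-a,b,-b)` with decomposable Weil classes): every rational `(5,5)`-class in the Weil plane of
`(J, φ = g(σ_*))` (`φ ≫ φ = -11` by `gaussSum_sq`) is algebraic.  Sources: card `balanced-undecic-pencil`;
TRIAGE-r1-1 §C/§E, r1-2 check C, r1-3 appendix A (arithmetic re-derived thrice); Moonen–Zarhin 1998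
(generic fibre: `W` exceptional).  OPEN (it is the card's NS problem plus nothing else). -/
def PencilCase : Prop :=
  ∀ (C : SchemeOver ℂ), IsSmoothProjective 1 C → ∀ (𝒥 : Jacobian C) (σ : C ⟶ C),
    (show CategoryTheory.End C from σ) ^ 11 = 1 →
    𝒥.J.dim = 10 →
    (Finset.range 11).sum (fun k => (show CategoryTheory.End 𝒥.J from 𝒥.pushforward 𝒥 σ) ^ k) = 0 →
    ∀ c : complexBetti 𝒥.J.X 10, IsRationalClass c → IsOfHodgeType 10 𝒥.J.X 10 5 5 c →
      c ∈ weilPlane 𝒥.J (gaussSum 𝒥.J (𝒥.pushforward 𝒥 σ)) → c ∈ algebraicClasses 𝒥.J.X 5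

/-- `PencilCase` is a literal special case of the crux (kernel-checked; so it is an honest test stub, not
a costume: proving it is partial progress, refuting it refutes the crux). -/
theorem pencilCase_of_crux (h : Crux) : PencilCase := by
  intro C _hC 𝒥 σ h11 hdim hnorm c hc hh hw
  have hζ : (show CategoryTheory.End 𝒥.J from 𝒥.pushforward 𝒥 σ) ^ 11 = 1 :=
    pushforward_pow_eleven 𝒥 σ h11
  exact h 𝒥.J (gaussSum 𝒥.J (𝒥.pushforward 𝒥 σ)) hdim (gaussSum_sq 𝒥.J _ hζ hnorm) c hc hh hw

/-! ## §2 The odd-rank junction: `JunctionCase` and the re-weighting lever -/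

/-- The CONJUGATE DOUBLE of a `K`-abelian variety `(B, ψ)`: the product `B × B` with the endomorphism
`ψ × (-ψ)` (factorwise `K`-structure, second factor with the conjugate embedding).  For `dim B = 5`,
`ψ ≫ ψ = -11`, of ANY signature `(p, 5-p)`, this is a `ℚ(√-11)`-Weil tenfold of signature `(5,5)`
(`V_σ = V_σ(B) ⊕ V_σ̄(B)`), K-split into two factors of ODD `K`-rank `5`. -/
def conjDouble (B : AbelianVariety ℂ) (ψ : B ⟶ B) : B.prod B ⟶ B.prod B :=
  AbelianVariety.prodLift (AbelianVariety.fst B B ≫ ψ) (AbelianVariety.snd B B ≫ (-ψ))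

/-- `(ψ × (-ψ))² = -11` on `B × B` when `ψ² = -11`. -/
theorem conjDouble_comp_self (B : AbelianVariety ℂ) (ψ : B ⟶ B) (hψ : ψ ≫ ψ = -((11 : ℤ) • 𝟙 B)) :
    conjDouble B ψ ≫ conjDouble B ψ = -((11 : ℤ) • 𝟙 (B.prod B)) := by
  have hψ' : ψ ≫ ψ = -((11 : ℕ) • 𝟙 B) := by rw [hψ, ← natCast_zsmul]; rfl
  have hneg : (-ψ) ≫ (-ψ) = -((11 : ℕ) • 𝟙 B) := by
    rw [Preadditive.neg_comp, Preadditive.comp_neg, neg_neg, hψ']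
  rw [conjDouble, prodLift_comp_self_eq_neg_nsmul hψ' hneg, ← natCast_zsmul]
  rfl

/-- **`JunctionCase` — the crux at the odd-rank junction hosts.**  For every complex abelian 5-fold `B`
with `ψ ≫ ψ = -11`: every rational `(5,5)`-class in the Weil plane of the conjugate double
`(B × B, ψ × (-ψ))` is algebraic.  TRUE in print for every `B` (card `weil-projector-graph-seeds`, seed
lemma, here in odd top degree `m = 5`, §3: the class of the signed graph cycle
`p(Γ_{𝟙+ψ}) = Σ_j c_j Γ_{(𝟙+ψ)^j} ⊂ B × B` is `w_σ + w_σ̄`, which with its `(𝟙+φ₀)^*`-image spans the plane;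
Lean needs products/Künneth/graph classes for `complexBetti` and `H¹⁰ = ∧¹⁰H¹`).  The pencil's cusp
`J₁ × J₁^{(8)}` (`ψ = g(ζ)`, `(8/11) = -1`) is the instance with the smallest endomorphism algebra among
graph-bearing CM hosts (`End⁰ = M₂(ℚ(ζ₁₁))`). -/
def JunctionCase : Prop :=
  ∀ (B : AbelianVariety ℂ) (ψ : B ⟶ B), B.dim = 5 → ψ ≫ ψ = -((11 : ℤ) • 𝟙 B) →
    ∀ c : complexBetti (B.prod B).X 10, IsRationalClass c → IsOfHodgeType 10 (B.prod B).X 10 5 5 c →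
      c ∈ weilPlane (B.prod B) (conjDouble B ψ) → c ∈ algebraicClasses (B.prod B).X 5

/-- `JunctionCase` is a literal special case of the crux (kernel-checked: `dim (B × B) = 10` by
`AbelianVariety.dim_prod`, `(ψ × (-ψ))² = -11` by `conjDouble_comp_self`). -/
theorem junctionCase_of_crux (h : Crux) : JunctionCase := by
  intro B ψ hB hψ c hc hh hw
  have hdim : (B.prod B).dim = 10 := by rw [AbelianVariety.dim_prod, hB]
  exact h (B.prod B) (conjDouble B ψ) hdim (conjDouble_comp_self B ψ hψ) c hc hh hw

/-- **The re-weighting lever (odd `K`-rank).**  On a `K`-split host `B × B'` whose factors have ODD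
`K`-rank `2m+1` (here `m = 2`), the product polarisation `a E_B ⊕ E_{B'}` has
`det H = a^{2m+1} det H_B det H_{B'}`; since `a^{2m+1} ≡ a` modulo squares, every target class `t` of the
same sign as `c := det(H_B ⊕ H_{B'})` is reached by a positive rational weight `a`:
`a^{2m+1} c = s² t`.  (For EVEN rank `2m` nothing moves: `a^{2m} c = (aᵐ)² c`.)  Both classes are
negative for Weil tenfolds (signature `(5,5)`), whence the hypotheses. -/
theorem oddRank_reweighting (m : ℕ) (c t : ℚ) (hc : c < 0) (ht : t < 0) :
    ∃ a : ℚ, 0 < a ∧ ∃ s : ℚ, s ≠ 0 ∧ a ^ (2 * m + 1) * c = s ^ 2 * t := by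
  refine ⟨t / c, div_pos_of_neg_of_neg ht hc, (t / c) ^ m, pow_ne_zero _ (div_ne_zero ht.ne hc.ne), ?_⟩
  have hc0 : c ≠ 0 := hc.ne
  rw [pow_succ, ← pow_mul, mul_comm m 2, pow_mul]
  field_simp

/-- The even-rank contrast: re-weighting a factor of even `K`-rank `2m` changes `det H` by a square. -/
theorem evenRank_reweighting_isSquare (m : ℕ) (a c : ℚ) :
    ∃ s : ℚ, a ^ (2 * m) * c = s ^ 2 * c :=
  ⟨a ^ m, by rw [mul_comm 2 m, pow_mul]⟩

/-! ## §3 Seed arithmetic in arbitrary top degree (odd case needed by the junction host) -/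

/-- The eigenvalue of `(𝟙 + ψ)^*` (`ψ ≫ ψ = -11`) on `∧ᵃV_σ ⊗ ∧ᵇV_σ̄ ⊂ H^{a+b}(B)`:
`λ_{a,b} = (1 + i√11)ᵃ (1 - i√11)ᵇ`.  [as in `IdeatorTwoSketchG2.weilNode`] -/
def weilNode (a b : ℕ) : ℂ :=
  (1 + Complex.I * (Real.sqrt (11 : ℝ) : ℂ)) ^ a * (1 - Complex.I * (Real.sqrt (11 : ℝ) : ℂ)) ^ b

/-- **Seed arithmetic, top degree `m`.**  There is `p ∈ ℂ[X]` with `p(λ_{m,0}) = p(λ_{0,m}) = 1` and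
`p(λ_{a,b}) = 0` for every other `(a,b) ∈ [0,m]²`.  For a `K`-abelian `m`-fold `(B, ψ)` the cycle
`p(Γ_{𝟙+ψ}) = Σ_j c_j Γ_{(𝟙+ψ)^j} ∈ CH^m(B × B)_ℂ` then acts on `H^*(B) = ∧^*(V_σ ⊕ V_σ̄)` as the projector
onto `∧ᵐV_σ ⊕ ∧ᵐV_σ̄ ⊂ Hᵐ(B)`; its class `e_σ^∨ ⊗ e_σ + e_σ̄^∨ ⊗ e_σ̄ = e_σ̄ ⊠ e_σ + e_σ ⊠ e_σ̄` (Poincaré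
duality pairs `∧ᵐV_σ` with `∧ᵐV_σ̄`) is the rational generator `w_σ̄ + w_σ` of the Weil plane of the
conjugate double `(B × B, ψ × (-ψ))` — for `m = 5` the junction host of §2.  The card
`weil-projector-graph-seeds` has the even case `m = 2n`. -/
def WeilProjectorPolynomialDeg (m : ℕ) : Prop :=
  ∃ p : Polynomial ℂ, p.eval (weilNode m 0) = 1 ∧ p.eval (weilNode 0 m) = 1 ∧
    ∀ a b : ℕ, a ≤ m → b ≤ m → (a, b) ≠ (m, 0) → (a, b) ≠ (0, m) → p.eval (weilNode a b) = 0

/-- `‖1 + i√11‖² = 12`. [as in IdeatorTwoSketchG2] -/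
theorem normSq_one_add : Complex.normSq (1 + Complex.I * (Real.sqrt (11 : ℝ) : ℂ)) = 12 := by
  rw [Complex.normSq_apply]
  have h : Real.sqrt (11 : ℝ) * Real.sqrt 11 = 11 := Real.mul_self_sqrt (by norm_num)
  simp
  nlinarith [h]

/-- `‖1 - i√11‖² = 12`. [as in IdeatorTwoSketchG2] -/
theorem normSq_one_sub : Complex.normSq (1 - Complex.I * (Real.sqrt (11 : ℝ) : ℂ)) = 12 := by
  rw [Complex.normSq_apply]
  have h : Real.sqrt (11 : ℝ) * Real.sqrt 11 = 11 := Real.mul_self_sqrt (by norm_num)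
  simp
  nlinarith [h]

/-- `‖λ_{a,b}‖² = 12^{a+b}`. -/
theorem normSq_weilNode (a b : ℕ) : Complex.normSq (weilNode a b) = 12 ^ (a + b) := by
  rw [weilNode, map_mul, map_pow, map_pow, normSq_one_add, normSq_one_sub, pow_add]

/-- Equal nodes have equal total degree. -/
theorem add_eq_of_weilNode_eq {a b a' b' : ℕ} (h : weilNode a b = weilNode a' b') :
    a + b = a' + b' := by
  have h1 := congrArg Complex.normSq h
  rw [normSq_weilNode, normSq_weilNode] at h1
  exact pow_right_injective₀ (by norm_num : (0 : ℝ) < 12) (by norm_num : (12 : ℝ) ≠ 1) h1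

/-- A non-corner node never equals the `+` corner `λ_{m,0}` (separation `weil_mixed_ne_plus`, landed
p73707, all degrees, `p = 11 ≠ 3`). -/
theorem weilNode_ne_plus {m a b : ℕ} (hab : (a, b) ≠ (m, 0)) : weilNode a b ≠ weilNode m 0 := by
  intro h
  have hsum : a + b = m := by simpa using add_eq_of_weilNode_eq h
  by_cases hb : b = 0
  · subst hb
    apply hab
    simp only [add_zero] at hsum
    rw [hsum]
  · have hb1 : 1 ≤ b := Nat.one_le_iff_ne_zero.2 hb
    have key := weil_mixed_ne_plus (p := 11) (by norm_num) (by norm_num) hsum hb1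
    apply key
    have h' := h
    simp only [weilNode, pow_zero, mul_one] at h'
    exact_mod_cast h'

/-- A non-corner node never equals the `-` corner `λ_{0,m}`. -/
theorem weilNode_ne_minus {m a b : ℕ} (hab : (a, b) ≠ (0, m)) : weilNode a b ≠ weilNode 0 m := by
  intro h
  have hsum : a + b = m := by simpa using add_eq_of_weilNode_eq h
  by_cases ha : a = 0
  · subst ha
    apply hab
    simp only [zero_add] at hsum
    rw [hsum]
  · have ha1 : 1 ≤ a := Nat.one_le_iff_ne_zero.2 ha
    have key := weil_mixed_ne_minus (p := 11) (by norm_num) (by norm_num) hsum ha1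
    apply key
    have h' := h
    simp only [weilNode, pow_zero, one_mul] at h'
    exact_mod_cast h'

/-- **The seed exists in every top degree `m ≥ 1`** (Lagrange interpolation on the finite node set).
[proof adapted from `IdeatorTwoSketchG2.weilProjectorPolynomial_holds`] -/
theorem weilProjectorPolynomialDeg_holds (m : ℕ) (_hm : 1 ≤ m) : WeilProjectorPolynomialDeg m := by
  classical
  let box : Finset (ℕ × ℕ) := Finset.range (m + 1) ×ˢ Finset.range (m + 1)
  let S : Finset ℂ := box.image fun ab => weilNode ab.1 ab.2
  let r : ℂ → ℂ := fun v => if v = weilNode m 0 ∨ v = weilNode 0 m then 1 else 0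
  refine ⟨Lagrange.interpolate S id r, ?_, ?_, ?_⟩
  · have hmem : weilNode m 0 ∈ S := Finset.mem_image.2 ⟨(m, 0), by simp [box], rfl⟩
    have := Lagrange.eval_interpolate_at_node r (Set.injOn_id _) hmem
    simpa [r] using this
  · have hmem : weilNode 0 m ∈ S := Finset.mem_image.2 ⟨(0, m), by simp [box], rfl⟩
    have := Lagrange.eval_interpolate_at_node r (Set.injOn_id _) hmem
    simp only [id] at this
    rw [this]
    simp [r]
  · intro a b ha hb hp hmi
    have hmem : weilNode a b ∈ S := Finset.mem_image.2 ⟨(a, b), by simp [box]; omega, rfl⟩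
    have := Lagrange.eval_interpolate_at_node r (Set.injOn_id _) hmem
    simp only [id] at this
    rw [this]
    simp [r, weilNode_ne_plus hp, weilNode_ne_minus hmi]

/-- The instance used by the junction host `B × B^c`, `dim B = 5`. -/
theorem weilProjectorPolynomialDeg_five : WeilProjectorPolynomialDeg 5 :=
  weilProjectorPolynomialDeg_holds 5 (by norm_num)

/-- The instance recovering the card's tenfold case `2n = 10`. -/
theorem weilProjectorPolynomialDeg_ten : WeilProjectorPolynomialDeg 10 :=
  weilProjectorPolynomialDeg_holds 10 (by norm_num)

end Summit.HodgeConjecture.HodgeConjecture.Cruxes.WeilTenfoldsSqrtMinus11.PencilPlan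

end
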